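import Mathlib.MeasureTheory.Integral.IntegralEqImproper
import Mathlib.Analysis.Calculus.ContDiff.Deriv
import Mathlib.Analysis.Calculus.Deriv.Support
import Mathlib.MeasureTheory.Function.LocallyIntegrable
import HarnessLib

/-!
# The weighted energy identity of the similarity backbone `1 + ½ξ∂ − ∂²` on the line

HONEST FRAMING (cell ns-blowup, seat ns-blowup-selfsim; GROUP B zone Z3, PROFILE-SPEC §5 SHEET-ℝ): **a calculus identity for the LINEAR
BACKBONE of the 1-D MODEL profile equation on `ℝ` (viscous gCLM / OSW sheet at `c_l = 1/2`); not Euler, not Navier–Stokes; «violates: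
none — MODEL».** Companion of `Literature/Analysis/Fourier/HilbertTransformLine*.lean` (the nonlocal term) and of
`SheetRowThirdHilbert.lean` (the exact row). For `B₀δ = δ + ½ξδ′ − δ″` — the linear part of the vorticity-scaled
backward-heat / Leray similarity operator in one dimension — and the weight `w(ξ) = c + ξ²`, two integrations by parts give

  `∫ (B₀δ)·(c+ξ²)·δ = ∫ (¾c − 1 + ¼ξ²) δ² + ∫ (c+ξ²) δ′²`,   in particular for `c = 2`:
  `∫ (B₀δ)·(2+ξ²)·δ = ¼ ∫ (2+ξ²) δ² + ∫ (2+ξ²) δ′²`                                           (E)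

— an IDENTITY, not an inequality: the backbone is `¼`-coercive in `L²(2+ξ²)` (and `¼` is the bottom of its essential spectrum there).
(It is the polynomial-weight analogue of the Gaussian-weight energy identities for the heat operator in similarity variables
`w_s − Δw + ½y·∇w` of Giga–Kohn 1985; in vorticity scaling the one-dimensional backbone sits on the coercive side.) We prove (E) for
general `c` under explicit integrability hypotheses (`backbone_energy_identity`) and discharge all of them for `C²` functions with compact
support (`backbone_energy_identity_of_contDiff`, `backbone_energy_identity_two`). It is estimate (2.1) of the SHEET-ℝ certificate frame
(HOME/selfsim/SHEET-R-FRAME-NOTE-v2.md §2; measured there: `¼` is the bottom of the essential spectrum of the linearisation in `H¹_{2+ξ²}`).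
No definition, no `Prop` hypothesis. WHAT THIS IS NOT: not NS — an integration-by-parts identity.
-/

namespace Summit.NavierStokesRegularity.OSWSelfSimilar
namespace SheetLineBackbone

open _root_.MeasureTheory Set Filter
open scoped Real Topology

/-- **Weighted energy identity of `B₀ = 1 + ½ξ∂ − ∂²`, weight `c + ξ²`** (explicit-hypothesis form): if `δ` has derivatives `δ′`, `δ″`
everywhere and the listed products are integrable, then `∫ (δ + ½ξδ′ − δ″)(c+ξ²)δ = ∫ (¾c − 1 + ¼ξ²) δ² + ∫ (c+ξ²) δ′²`.
(By parts: `∫ ½ξ(c+ξ²)δδ′ = −¼∫(c+3ξ²)δ²`, `−∫(c+ξ²)δδ″ = ∫(c+ξ²)δ′² + ∫2ξδδ′`, `∫ 2ξδδ′ = −∫δ²`.)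
[folklore] -/
theorem backbone_energy_identity (c : ℝ) {δ δ' δ'' : ℝ → ℝ}
    (hd1 : ∀ ξ, HasDerivAt δ (δ' ξ) ξ) (hd2 : ∀ ξ, HasDerivAt δ' (δ'' ξ) ξ)
    (h1 : Integrable fun ξ => ξ * (c + ξ ^ 2) * (2 * (δ ξ * δ' ξ)))
    (h2 : Integrable fun ξ => (c + 3 * ξ ^ 2) * δ ξ ^ 2)
    (h3 : Integrable fun ξ => ξ * (c + ξ ^ 2) * δ ξ ^ 2)
    (h4 : Integrable fun ξ => (c + ξ ^ 2) * δ ξ * δ'' ξ)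
    (h5 : Integrable fun ξ => (2 * ξ * δ ξ + (c + ξ ^ 2) * δ' ξ) * δ' ξ)
    (h6 : Integrable fun ξ => (c + ξ ^ 2) * δ ξ * δ' ξ)
    (h7 : Integrable fun ξ => (c + ξ ^ 2) * δ ξ ^ 2)
    (h8 : Integrable fun ξ => (c + ξ ^ 2) * δ' ξ ^ 2)
    (h9 : Integrable fun ξ => δ ξ ^ 2)
    (h10 : Integrable fun ξ => ξ * δ ξ ^ 2) :
    ∫ ξ, (δ ξ + ξ / 2 * δ' ξ - δ'' ξ) * ((c + ξ ^ 2) * δ ξ) =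
      (∫ ξ, (3 / 4 * c - 1 + ξ ^ 2 / 4) * δ ξ ^ 2) + ∫ ξ, (c + ξ ^ 2) * δ' ξ ^ 2 := by
  -- (P1) u = ξ(c+ξ²), v = δ²
  have hu1 : ∀ ξ, HasDerivAt (fun ξ : ℝ => ξ * (c + ξ ^ 2)) (c + 3 * ξ ^ 2) ξ := by
    intro ξ
    have h := (hasDerivAt_id' ξ).mul ((hasDerivAt_pow 2 ξ).const_add c)
    refine h.congr_deriv ?_
    simp only [Nat.cast_ofNat]
    ring
  have hv1 : ∀ ξ, HasDerivAt (fun ξ : ℝ => δ ξ ^ 2) (2 * (δ ξ * δ' ξ)) ξ := by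
    intro ξ
    have h := (hd1 ξ).pow 2
    refine h.congr_deriv ?_
    simp only [Nat.cast_ofNat]
    ring
  have P1 : ∫ ξ, ξ * (c + ξ ^ 2) * (2 * (δ ξ * δ' ξ)) = -∫ ξ, (c + 3 * ξ ^ 2) * δ ξ ^ 2 :=
    integral_mul_deriv_eq_deriv_mul_of_integrable (u := fun ξ : ℝ => ξ * (c + ξ ^ 2)) (v := fun ξ => δ ξ ^ 2)
      (fun ξ _ => hu1 ξ) (fun ξ _ => hv1 ξ) h1 h2 h3
  -- (P2) u = (c+ξ²)δ, v = δ′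
  have hu2 : ∀ ξ, HasDerivAt (fun ξ : ℝ => (c + ξ ^ 2) * δ ξ) (2 * ξ * δ ξ + (c + ξ ^ 2) * δ' ξ) ξ := by
    intro ξ
    have h := ((hasDerivAt_pow 2 ξ).const_add c).mul (hd1 ξ)
    refine h.congr_deriv ?_
    simp only [Nat.cast_ofNat]
    ring
  have P2 : ∫ ξ, (c + ξ ^ 2) * δ ξ * δ'' ξ = -∫ ξ, (2 * ξ * δ ξ + (c + ξ ^ 2) * δ' ξ) * δ' ξ :=
    integral_mul_deriv_eq_deriv_mul_of_integrable (u := fun ξ : ℝ => (c + ξ ^ 2) * δ ξ) (v := δ')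
      (fun ξ _ => hu2 ξ) (fun ξ _ => hd2 ξ) h4 h5 h6
  -- (P3) u = ξ, v = δ²:  ∫ ξ·(2δδ′) = −∫ δ²
  have h11 : Integrable fun ξ => ξ * (2 * (δ ξ * δ' ξ)) := by
    refine (h5.sub h8).congr (Eventually.of_forall fun ξ => ?_)
    simp only [Pi.sub_apply]
    ring
  have h9' : Integrable fun ξ : ℝ => (1 : ℝ) * δ ξ ^ 2 := by simpa using h9
  have P3 : ∫ ξ, ξ * (2 * (δ ξ * δ' ξ)) = -∫ ξ, (1 : ℝ) * δ ξ ^ 2 :=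
    integral_mul_deriv_eq_deriv_mul_of_integrable (u := fun ξ : ℝ => ξ) (v := fun ξ => δ ξ ^ 2) (u' := fun _ => (1 : ℝ))
      (fun ξ _ => hasDerivAt_id' ξ) (fun ξ _ => hv1 ξ) h11 h9' h10
  -- split the left-hand side
  have hA : Integrable fun ξ => δ ξ * ((c + ξ ^ 2) * δ ξ) := by
    refine h7.congr (Eventually.of_forall fun ξ => ?_); ring
  have hB : Integrable fun ξ => ξ / 2 * δ' ξ * ((c + ξ ^ 2) * δ ξ) := by
    refine (h1.const_mul (1 / 4)).congr (Eventually.of_forall fun ξ => ?_); ring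
  have hC : Integrable fun ξ => δ'' ξ * ((c + ξ ^ 2) * δ ξ) := by
    refine h4.congr (Eventually.of_forall fun ξ => ?_); ring
  have hsplit : (fun ξ => (δ ξ + ξ / 2 * δ' ξ - δ'' ξ) * ((c + ξ ^ 2) * δ ξ)) =
      fun ξ => (δ ξ * ((c + ξ ^ 2) * δ ξ) + ξ / 2 * δ' ξ * ((c + ξ ^ 2) * δ ξ)) - δ'' ξ * ((c + ξ ^ 2) * δ ξ) := by
    funext ξ; ring
  have hAB : Integrable fun ξ => δ ξ * ((c + ξ ^ 2) * δ ξ) + ξ / 2 * δ' ξ * ((c + ξ ^ 2) * δ ξ) := hA.add hB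
  rw [hsplit, integral_sub hAB hC, integral_add hA hB]
  -- evaluate the three pieces
  have vA : ∫ ξ, δ ξ * ((c + ξ ^ 2) * δ ξ) = ∫ ξ, (c + ξ ^ 2) * δ ξ ^ 2 := by
    refine integral_congr_ae (Eventually.of_forall fun ξ => ?_); ring
  have vB : ∫ ξ, ξ / 2 * δ' ξ * ((c + ξ ^ 2) * δ ξ) = -(1 / 4) * ∫ ξ, (c + 3 * ξ ^ 2) * δ ξ ^ 2 := by
    have e : (fun ξ => ξ / 2 * δ' ξ * ((c + ξ ^ 2) * δ ξ)) = fun ξ => (1 / 4) * (ξ * (c + ξ ^ 2) * (2 * (δ ξ * δ' ξ))) := by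
      funext ξ; ring
    rw [e, integral_const_mul, P1]
    ring
  have vC : ∫ ξ, δ'' ξ * ((c + ξ ^ 2) * δ ξ) = (∫ ξ, δ ξ ^ 2) - ∫ ξ, (c + ξ ^ 2) * δ' ξ ^ 2 := by
    have e : (fun ξ => δ'' ξ * ((c + ξ ^ 2) * δ ξ)) = fun ξ => (c + ξ ^ 2) * δ ξ * δ'' ξ := by funext ξ; ring
    have e2 : (fun ξ => (2 * ξ * δ ξ + (c + ξ ^ 2) * δ' ξ) * δ' ξ) =
        fun ξ => ξ * (2 * (δ ξ * δ' ξ)) + (c + ξ ^ 2) * δ' ξ ^ 2 := by funext ξ; ring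
    rw [e, P2, e2, integral_add h11 h8, P3]
    simp only [one_mul]
    ring
  -- assemble the right-hand side
  have eR : (fun ξ => (3 / 4 * c - 1 + ξ ^ 2 / 4) * δ ξ ^ 2) =
      fun ξ => ((c + ξ ^ 2) * δ ξ ^ 2 - (1 / 4) * ((c + 3 * ξ ^ 2) * δ ξ ^ 2)) - δ ξ ^ 2 := by
    funext ξ; ring
  have h2' : Integrable fun ξ => 1 / 4 * ((c + 3 * ξ ^ 2) * δ ξ ^ 2) := h2.const_mul (1 / 4)
  have hR1 : Integrable fun ξ => (c + ξ ^ 2) * δ ξ ^ 2 - 1 / 4 * ((c + 3 * ξ ^ 2) * δ ξ ^ 2) := h7.sub h2'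
  rw [vA, vB, vC, eR, integral_sub hR1 h9, integral_sub h7 h2', integral_const_mul]
  ring

/-- **(E) for `C²` functions with compact support** (all integrability hypotheses discharged): for `δ ∈ C²_c(ℝ)` and any `c`,
`∫ (δ + ½ξδ′ − δ″)(c+ξ²)δ = ∫ (¾c − 1 + ¼ξ²) δ² + ∫ (c+ξ²) δ′²` with `δ′ = deriv δ`, `δ″ = deriv (deriv δ)`.
[folklore] -/
theorem backbone_energy_identity_of_contDiff (c : ℝ) {δ : ℝ → ℝ} (hδ : ContDiff ℝ 1 δ) (hδ' : ContDiff ℝ 1 (deriv δ))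
    (hs : HasCompactSupport δ) :
    ∫ ξ, (δ ξ + ξ / 2 * deriv δ ξ - deriv (deriv δ) ξ) * ((c + ξ ^ 2) * δ ξ) =
      (∫ ξ, (3 / 4 * c - 1 + ξ ^ 2 / 4) * δ ξ ^ 2) + ∫ ξ, (c + ξ ^ 2) * deriv δ ξ ^ 2 := by
  have hd1 : ∀ ξ, HasDerivAt δ (deriv δ ξ) ξ := fun ξ => (hδ.differentiable one_ne_zero ξ).hasDerivAt
  have hd2 : ∀ ξ, HasDerivAt (deriv δ) (deriv (deriv δ) ξ) ξ := fun ξ => (hδ'.differentiable one_ne_zero ξ).hasDerivAt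
  have c0 : Continuous δ := hδ.continuous
  have c1 : Continuous (deriv δ) := hδ'.continuous
  have c2 : Continuous (deriv (deriv δ)) := hδ'.continuous_deriv le_rfl
  have s1 : HasCompactSupport (deriv δ) := hs.deriv
  -- every integrand is (continuous) × (δ or δ′), hence continuous with compact support
  have I : ∀ g : ℝ → ℝ, Continuous g → Integrable fun ξ => g ξ * δ ξ := fun g hg =>
    (hg.mul c0).integrable_of_hasCompactSupport hs.mul_left
  have I' : ∀ g : ℝ → ℝ, Continuous g → Integrable fun ξ => g ξ * deriv δ ξ := fun g hg =>
    (hg.mul c1).integrable_of_hasCompactSupport s1.mul_left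
  refine backbone_energy_identity c hd1 hd2 ?_ ?_ ?_ ?_ ?_ ?_ ?_ ?_ ?_ ?_
  · refine (I (fun ξ => ξ * (c + ξ ^ 2) * (2 * deriv δ ξ)) (by fun_prop)).congr (Eventually.of_forall fun ξ => ?_); ring
  · refine (I (fun ξ => (c + 3 * ξ ^ 2) * δ ξ) (by fun_prop)).congr (Eventually.of_forall fun ξ => ?_); ring
  · refine (I (fun ξ => ξ * (c + ξ ^ 2) * δ ξ) (by fun_prop)).congr (Eventually.of_forall fun ξ => ?_); ring
  · refine (I (fun ξ => (c + ξ ^ 2) * deriv (deriv δ) ξ) (by fun_prop)).congr (Eventually.of_forall fun ξ => ?_); ring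
  · refine (I' (fun ξ => 2 * ξ * δ ξ + (c + ξ ^ 2) * deriv δ ξ) (by fun_prop)).congr
      (Eventually.of_forall fun ξ => ?_); ring
  · refine (I' (fun ξ => (c + ξ ^ 2) * δ ξ) (by fun_prop)).congr (Eventually.of_forall fun ξ => ?_); ring
  · refine (I (fun ξ => (c + ξ ^ 2) * δ ξ) (by fun_prop)).congr (Eventually.of_forall fun ξ => ?_); ring
  · refine (I' (fun ξ => (c + ξ ^ 2) * deriv δ ξ) (by fun_prop)).congr (Eventually.of_forall fun ξ => ?_); ring
  · refine (I (fun ξ => δ ξ) c0).congr (Eventually.of_forall fun ξ => ?_); ring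
  · refine (I (fun ξ => ξ * δ ξ) (by fun_prop)).congr (Eventually.of_forall fun ξ => ?_); ring

/-- **(E) at the weight `2 + ξ²`** — the form used by the SHEET-ℝ frame: for `δ ∈ C²_c(ℝ)`,
`∫ (δ + ½ξδ′ − δ″)(2+ξ²)δ = ¼∫(2+ξ²)δ² + ∫(2+ξ²)δ′²`: `B₀` is `¼`-coercive in `L²(2+ξ²)`, identically.
[folklore] -/
theorem backbone_energy_identity_two {δ : ℝ → ℝ} (hδ : ContDiff ℝ 1 δ) (hδ' : ContDiff ℝ 1 (deriv δ))
    (hs : HasCompactSupport δ) :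
    ∫ ξ, (δ ξ + ξ / 2 * deriv δ ξ - deriv (deriv δ) ξ) * ((2 + ξ ^ 2) * δ ξ) =
      (1 / 4) * (∫ ξ, (2 + ξ ^ 2) * δ ξ ^ 2) + ∫ ξ, (2 + ξ ^ 2) * deriv δ ξ ^ 2 := by
  rw [backbone_energy_identity_of_contDiff 2 hδ hδ' hs, ← integral_const_mul]
  congr 1
  refine integral_congr_ae (Eventually.of_forall fun ξ => ?_)
  ring

end SheetLineBackbone
end Summit.NavierStokesRegularity.OSWSelfSimilar
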